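import Summits.BirchSwinnertonDyer.BirchSwinnertonDyer.Theorems.GoldfeldAllTwistsTwoConverseTwinAdditiveTwoSplitSevenTwistSelmer
import Summits.BirchSwinnertonDyer.BirchSwinnertonDyer.Theorems.GoldfeldAllTwistsTwoConverseTwinAdditiveSplitPrimeTwistSelmer
import HarnessLib

set_option linter.dupNamespace false -- namespace `…BirchSwinnertonDyer.BirchSwinnertonDyer…` is the cell's (D-0017 nested layout)
set_option autoImplicit false

/-!
# Twin″ (item 19140), XIX: a second `2`-adic valuation recursion and the Selmer orders of `49a1^{(−2ℓ)}`,
# `ℓ ≡ 3 (mod 8)` prime SPLIT in `ℚ(√−7)` (`#S ≤ 4`, `#S' ≤ 2`)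

Cell `bsd-goldfeld`, seat `bsd-goldfeld-s1p-c301` (gen 3); `--supports stmt-BirchSwinnertonDyer-19140`. For
`E_{−2ℓ} : y² = x³ − 42ℓx² + 448ℓ²x`, `ℓ ≡ 3 (mod 8)` prime with `(−7/ℓ) = +1` (`ℓ = 11, 43, 67, 107, …`; `30` members
with `|d| ≤ 3000`, all of analytic rank `1`, all resolved: `Ш[2] = 0`, `#Ш_an = 1`; numerically `S = {1,2,7,14}`,
`S' = {1,−7}`):

* `not_sq_eq_twoSplitThree_chartB` — the class `ℓ ∈ S(−42ℓ,448ℓ²)` dies ONLY at `2`, in the chart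
  `s² = 448ℓ − 42ℓt² + ℓt⁴` by a valuation recursion (`t`, `t/2`, `t/4` even in turn; `decide` mod `16`, as in part XIV).
* `card_twoIsogenySelmerGroup_twoSplitThreeTwist_le`: **`#S(−42ℓ,448ℓ²) ≤ 4`** (real place; the class `ℓ` at `2`;
  seven survivors `{1,2,7,14,2ℓ,7ℓ,14ℓ}`, `#S = 2^k`).
* `card_twoIsogenySelmerGroup'_twoSplitThreeTwist_le`: **`#S(84ℓ,−28ℓ²) ≤ 2`** — the eight `ℓ`-classes die at `ℓ`
  (`7·32²` non-residue, `(7/ℓ) = −1`), `−1, −2, 7, 14` at `7` (`ℓ` is a residue mod `7`), and `2, −14` at `ℓ`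
  (`(2/ℓ) = (−14/ℓ) = −1` for `ℓ ≡ 3 (mod 8)`, gen 2's `not_isSoluble_padic_of_nonresidue_of_sq_dvd`); `S' ⊆ {1, −7}`.
Consequences in part XX; then `49a1^{(−2ℓ)}` is treated for every prime `ℓ` except the split `ℓ ≡ 1 (mod 8)`.
HONEST FRAMING: no `BSD(W,2)` is proved; BSD is not proved by any of this.

References: Silverman, *AEC* (2009), X.4.9–X.4.10 [SilvermanAEC2009]; Zywina, arXiv:2502.01957, Lemma 3.1 [Zywina2025].
-/

noncomputable section

open scoped Classical

open WeierstrassCurve Literature.NumberTheory.EllipticCurves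
open Literature.NumberTheory.EllipticCurves.Zywina2025 (exists_padicInt_of_isSoluble
  isSquare_zmod_of_isSoluble_padic)

namespace Summit.BirchSwinnertonDyer.BirchSwinnertonDyer.Theorems.GoldfeldGoodTwists

/-! ## §1. The valuation recursion in `ℤ₂` for the class `ℓ` -/

/-- An element of `ℤ₂` whose residue mod `16` has even representative is divisible by `2`. [folklore] -/
private theorem two_dvd_of_even_val3 {X : ℤ_[2]} (hX : Even (((PadicInt.toZModPow 4 X).val : ℤ))) :
    (2 : ℤ_[2]) ∣ X := by
  set ψ : ℤ_[2] →+* ZMod (2 ^ 4) := PadicInt.toZModPow 4 with hψdef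
  obtain ⟨x₁, hx₁⟩ := hX
  have h1 : ψ X = ψ (2 * (x₁ : ℤ_[2])) := by
    rw [map_mul, map_intCast, map_ofNat, ← ZMod.natCast_zmod_val (ψ X)]
    have h2 : (((ψ X).val : ℤ) : ZMod (2 ^ 4)) = ((x₁ + x₁ : ℤ) : ZMod (2 ^ 4)) := by rw [hx₁]
    push_cast at h2
    rw [h2]; ring
  have h2 : X - 2 * (x₁ : ℤ_[2]) ∈ RingHom.ker ψ := by
    rw [RingHom.mem_ker, map_sub, h1, sub_self]
  rw [hψdef, PadicInt.ker_toZModPow, Ideal.mem_span_singleton] at h2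
  obtain ⟨c, hc⟩ := h2
  refine ⟨2 ^ 3 * c + x₁, ?_⟩
  have hc' : X = ((2 : ℕ) : ℤ_[2]) ^ 4 * c + 2 * x₁ := by rw [← hc]; ring
  rw [hc']; push_cast; ring

/-- The four finite checks mod `16` of the recursion (`x = ℓ mod 16 ∈ {3, 11}`). [folklore] -/
private theorem zmod_sixteen_steps3 : ∀ x T S : ZMod 16, (x = 3 ∨ x = 11) →
    (S ^ 2 = 448 * x - 42 * x * T ^ 2 + x * T ^ 4 → Even ((T.val : ℤ))) ∧
    (2 * S ^ 2 = x * (2 * T ^ 4 - 21 * T ^ 2 + 56) → Even ((T.val : ℤ))) ∧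
    (2 * S ^ 2 = x * (8 * T ^ 4 - 21 * T ^ 2 + 14) → Even ((T.val : ℤ))) ∧
    (S ^ 2 ≠ x * (64 * T ^ 4 - 42 * T ^ 2 + 7)) := by
  decide

/-- `ℓ ≡ 3 (mod 8)` ⇒ `ℓ mod 16 ∈ {3, 11}`. [folklore] -/
private theorem zmod_sixteen_of_mod_eight_three {l : ℕ} (hl8 : l % 8 = 3) :
    (l : ZMod 16) = 3 ∨ (l : ZMod 16) = 11 := by
  have h : l % 16 = 3 ∨ l % 16 = 11 := by omega
  rw [← ZMod.natCast_mod l 16]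
  rcases h with h | h <;> rw [h] <;> norm_num

/-- **The valuation recursion.** For `ℓ ≡ 3 (mod 8)` the equation `s² = 448ℓ − 42ℓ t² + ℓ t⁴` has no solution in
`ℤ₂`. [folklore] -/
theorem not_sq_eq_twoSplitThree_chartB {l : ℕ} (hl8 : l % 8 = 3) {t s : ℤ_[2]}
    (h : s ^ 2 = 448 * (l : ℤ_[2]) - 42 * (l : ℤ_[2]) * t ^ 2 + (l : ℤ_[2]) * t ^ 4) : False := by
  have hP : Prime (2 : ℤ_[2]) := by simpa using (PadicInt.prime_p (p := 2))
  have h20 : (2 : ℤ_[2]) ≠ 0 := hP.ne_zero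
  have hx := zmod_sixteen_of_mod_eight_three hl8
  set ψ : ℤ_[2] →+* ZMod (2 ^ 4) := PadicInt.toZModPow 4 with hψdef
  have hψl : ψ (l : ℤ_[2]) = (l : ZMod 16) := by rw [map_natCast]
  -- step 0: `t` is even
  have ht : (2 : ℤ_[2]) ∣ t := by
    apply two_dvd_of_even_val3
    have e := congrArg ψ h
    simp only [map_add, map_sub, map_mul, map_pow, map_ofNat, hψl] at e
    exact (zmod_sixteen_steps3 (l : ZMod 16) (ψ t) (ψ s) hx).1 e
  obtain ⟨t₁, rfl⟩ := ht
  -- `s = 4 s₂`, `2 s₂² = ℓ (2t₁⁴ − 21t₁² + 56)`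
  have hN : s ^ 2 = 2 * (4 * ((l : ℤ_[2]) * (2 * t₁ ^ 4 - 21 * t₁ ^ 2 + 56))) := by
    linear_combination h
  have hs : (2 : ℤ_[2]) ∣ s := hP.dvd_of_dvd_pow (n := 2) ⟨_, hN⟩
  obtain ⟨s₁, rfl⟩ := hs
  have hN1 : s₁ ^ 2 = 2 * ((l : ℤ_[2]) * (2 * t₁ ^ 4 - 21 * t₁ ^ 2 + 56)) :=
    mul_left_cancel₀ h20 (mul_left_cancel₀ h20 (by linear_combination hN))
  have hs₁ : (2 : ℤ_[2]) ∣ s₁ := hP.dvd_of_dvd_pow (n := 2) ⟨_, hN1⟩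
  obtain ⟨s₂, rfl⟩ := hs₁
  have h1 : 2 * s₂ ^ 2 = (l : ℤ_[2]) * (2 * t₁ ^ 4 - 21 * t₁ ^ 2 + 56) :=
    mul_left_cancel₀ h20 (by linear_combination hN1)
  -- `t₁` is even
  have ht₁ : (2 : ℤ_[2]) ∣ t₁ := by
    apply two_dvd_of_even_val3
    have e := congrArg ψ h1
    simp only [map_add, map_sub, map_mul, map_pow, map_ofNat, hψl] at e
    exact (zmod_sixteen_steps3 (l : ZMod 16) (ψ t₁) (ψ s₂) hx).2.1 e
  obtain ⟨t₂, rfl⟩ := ht₁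
  -- `s₂ = 2 s₃`, `2 s₃² = ℓ (8t₂⁴ − 21t₂² + 14)`
  have hN2 : s₂ ^ 2 = 2 * ((l : ℤ_[2]) * (8 * t₂ ^ 4 - 21 * t₂ ^ 2 + 14)) :=
    mul_left_cancel₀ h20 (by linear_combination h1)
  have hs₂ : (2 : ℤ_[2]) ∣ s₂ := hP.dvd_of_dvd_pow (n := 2) ⟨_, hN2⟩
  obtain ⟨s₃, rfl⟩ := hs₂
  have h2 : 2 * s₃ ^ 2 = (l : ℤ_[2]) * (8 * t₂ ^ 4 - 21 * t₂ ^ 2 + 14) :=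
    mul_left_cancel₀ h20 (by linear_combination hN2)
  -- `t₂` is even
  have ht₂ : (2 : ℤ_[2]) ∣ t₂ := by
    apply two_dvd_of_even_val3
    have e := congrArg ψ h2
    simp only [map_add, map_sub, map_mul, map_pow, map_ofNat, hψl] at e
    exact (zmod_sixteen_steps3 (l : ZMod 16) (ψ t₂) (ψ s₃) hx).2.2.1 e
  obtain ⟨t₃, rfl⟩ := ht₂
  -- `s₃² = ℓ (64t₃⁴ − 42t₃² + 7)`, impossible mod 16
  have h3 : s₃ ^ 2 = (l : ℤ_[2]) * (64 * t₃ ^ 4 - 42 * t₃ ^ 2 + 7) :=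
    mul_left_cancel₀ h20 (by linear_combination h2)
  have e := congrArg ψ h3
  simp only [map_add, map_sub, map_mul, map_pow, map_ofNat, hψl] at e
  exact (zmod_sixteen_steps3 (l : ZMod 16) (ψ t₃) (ψ s₃) hx).2.2.2 e

/-- Chart `(ℓ, 448ℓ)` of the class `ℓ ∈ S`, as a residue check mod `8` (`x = ℓ ≡ 3`). [folklore] -/
private theorem zmod8_chartA3 : ∀ x : ZMod 8, x = 3 →
    ∀ T S : ZMod 8, S ^ 2 ≠ x - 42 * x * T ^ 2 + 448 * x * T ^ 4 := by
  decide

/-- **The class `ℓ` of `S(−42ℓ, 448ℓ²)` has no `ℚ₂`-point** for `ℓ ≡ 3 (mod 8)` (chart `(ℓ, 448ℓ)`: residues mod `8`;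
chart `(448ℓ, ℓ)`: the valuation recursion). [cite: SilvermanAEC2009, Prop. X.4.9 and Example X.4.10] -/
theorem not_isSoluble_two_twoSplitThree_l {l : ℕ} (hl8 : l % 8 = 3) :
    ¬ ((twoIsogenyQuartic (-42 * l) l (448 * l)).map (Int.castRingHom ℚ_[2])).IsSoluble := by
  haveI : Fact (Nat.Prime 2) := ⟨Nat.prime_two⟩
  intro h
  obtain ⟨f, f', hff, t, s, hs⟩ := exists_padicInt_of_isSoluble h
  rcases hff with ⟨rfl, rfl⟩ | ⟨rfl, rfl⟩
  · have hx : (l : ZMod 8) = 3 := by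
      rw [← ZMod.natCast_mod l 8, hl8]; norm_num
    have h2 := congrArg (PadicInt.toZModPow 3 : ℤ_[2] →+* ZMod (2 ^ 3)) hs
    simp only [map_pow, map_add, map_mul, map_intCast] at h2
    push_cast at h2
    exact zmod8_chartA3 (l : ZMod 8) hx (PadicInt.toZModPow 3 t) (PadicInt.toZModPow 3 s)
      (by linear_combination h2)
  · push_cast at hs
    exact not_sq_eq_twoSplitThree_chartB hl8 (t := t) (s := s) (by linear_combination hs)

/-! ## §2. Inputs at `7` and at `ℓ` for split `ℓ ≡ 3 (mod 8)` -/

/-- The `7`-adic non-residue table for a RESIDUE `x ∈ {1, 2, 4}` mod `7`: `−1, −2, −4x², −2x²` are non-squares.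
[folklore] -/
private theorem zmod_seven_table7_split3 : ∀ x : ZMod 7, (x = 1 ∨ x = 2 ∨ x = 4) →
    ∀ r : ZMod 7, r * r ≠ -1 ∧ r * r ≠ -2 ∧ r * r ≠ -4 * x ^ 2 ∧ r * r ≠ -2 * x ^ 2 := by
  decide

/-- The nonzero residues mod `7` are `1, 2, 4`. [folklore] -/
private theorem zmod_seven_residue_cases73 : ∀ x : ZMod 7, x ≠ 0 → IsSquare x → (x = 1 ∨ x = 2 ∨ x = 4) := by
  decide

/-- `ℓ ≡ 3 (mod 4)` SPLIT in `ℚ(√−7)` (`(−7/ℓ) = 1`), `ℓ ≠ 7`: `(7/ℓ) = −1` and, by reciprocity, `ℓ` is a nonzero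
RESIDUE mod `7`. [folklore] -/
private theorem seven_nonresidue_and_l_residue3 {l : ℕ} [Fact l.Prime] (hl4 : l % 4 = 3)
    (hl7 : legendreSym l (-7) = 1) (hl7' : l ≠ 7) :
    legendreSym l 7 = -1 ∧ ((l : ℤ) : ZMod 7) ≠ 0 ∧ IsSquare ((l : ℤ) : ZMod 7) := by
  haveI : Fact (Nat.Prime 7) := ⟨by norm_num⟩
  have hl2 : l ≠ 2 := by rintro rfl; norm_num at hl4
  have hm1 : legendreSym l (-1) = -1 := by
    rw [legendreSym.at_neg_one hl2, ZMod.χ₄_nat_three_mod_four hl4]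
  have h7 : legendreSym l 7 = -1 := by
    have hmul : legendreSym l (-7) = legendreSym l (-1) * legendreSym l 7 := by
      rw [← legendreSym.mul]; norm_num
    rw [hmul, hm1] at hl7
    linarith
  have hl07 : ((l : ℤ) : ZMod 7) ≠ 0 := by
    rw [Ne, ZMod.intCast_zmod_eq_zero_iff_dvd]
    intro h
    exact hl7' ((Nat.prime_dvd_prime_iff_eq (by norm_num) Fact.out).mp (by exact_mod_cast h)).symm
  refine ⟨h7, hl07, ?_⟩
  have h7l : legendreSym 7 l = 1 := by
    rw [legendreSym.quadratic_reciprocity_three_mod_four (by omega) (by norm_num)]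
    push_cast
    rw [h7]; norm_num
  have hsq := (legendreSym.eq_one_iff 7 (by exact_mod_cast hl07)).mp h7l
  exact_mod_cast hsq


/-- For `ℓ ≡ 3 (mod 8)` with `(7/ℓ) = −1`: `2` and `−14` are NON-residues mod `ℓ` (`(2/ℓ) = −1`,
`(−14/ℓ) = (−1/ℓ)(2/ℓ)(7/ℓ) = −1`). [folklore] -/
private theorem two_and_neg14_nonresidue {l : ℕ} [Fact l.Prime] (hl8 : l % 8 = 3) (h7 : legendreSym l 7 = -1) :
    ¬ IsSquare ((2 : ℤ) : ZMod l) ∧ ¬ IsSquare ((-14 : ℤ) : ZMod l) := by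
  have hl2 : l ≠ 2 := by rintro rfl; norm_num at hl8
  have h2 : legendreSym l 2 = -1 := by
    rw [legendreSym.at_two hl2, ZMod.χ₈_nat_eq_if_mod_eight]
    have h1 : l % 2 ≠ 0 := by omega
    have h2' : ¬ (l % 8 = 1 ∨ l % 8 = 7) := by omega
    simp [h1, h2']
  have hm1 : legendreSym l (-1) = -1 := by
    rw [legendreSym.at_neg_one hl2, ZMod.χ₄_nat_three_mod_four (by omega)]
  have hm14 : legendreSym l (-14) = -1 := by
    have hmul : legendreSym l (-14) = legendreSym l (-1) * legendreSym l 2 * legendreSym l 7 := by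
      rw [← legendreSym.mul, ← legendreSym.mul]; norm_num
    rw [hmul, hm1, h2, h7]; norm_num
  exact ⟨(legendreSym.eq_neg_one_iff l).mp h2, (legendreSym.eq_neg_one_iff l).mp hm14⟩

/-! ## §3. The Selmer orders -/

/-- **`#S(−42ℓ, 448ℓ²) ≤ 4`** for a prime `ℓ ≡ 3 (mod 8)` (no splitting hypothesis needed): the negative classes die
at the real place and the class `ℓ` at `2`, so `S ⊆ {1, 2, 7, 14, 2ℓ, 7ℓ, 14ℓ}` and `#S = 2^k ≤ 4`.
[cite: SilvermanAEC2009, Prop. X.4.9 and Example X.4.10] -/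
theorem card_twoIsogenySelmerGroup_twoSplitThreeTwist_le {l : ℕ} [Fact l.Prime] (hl8 : l % 8 = 3) :
    (twoIsogenySelmerGroup (-42 * l) (448 * l ^ 2)).card ≤ 4 := by
  have hl : l.Prime := Fact.out
  have hlp : Prime (l : ℤ) := Nat.prime_iff_prime_int.mp hl
  have hl0 : (l : ℤ) ≠ 0 := by exact_mod_cast hl.ne_zero
  have hb : (448 * l ^ 2 : ℤ) ≠ 0 := by positivity
  have hsub : twoIsogenySelmerGroup (-42 * l) (448 * l ^ 2) ⊆
      ({1, 2, 7, 14, (l : ℤ) * 2, (l : ℤ) * 7} ∪ {(l : ℤ) * 14} : Finset ℤ) := by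
    intro d hd
    rw [mem_twoIsogenySelmerGroup_iff hb] at hd
    obtain ⟨hsqf, ⟨d', hdd'⟩, hloc⟩ := hd
    have hd'eq : (448 * l ^ 2 : ℤ) / d = d' := by
      rw [hdd', Int.mul_ediv_cancel_left _ hsqf.ne_zero]
    rw [hd'eq] at hloc
    obtain ⟨hreal, hpadic⟩ := hloc
    have hdpos : 0 < d := by
      rcases lt_or_gt_of_ne hsqf.ne_zero with hneg | hpos
      · exfalso
        have hbpos : (0 : ℤ) < 448 * (l : ℤ) ^ 2 := by positivity
        have hd'neg : d' < 0 := by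
          by_contra hcon
          nlinarith [mul_nonpos_iff.mpr (Or.inr ⟨hneg.le, le_of_not_gt hcon⟩)]
        have ha : (-42 * (l : ℤ)) ≤ 0 := by
          have : (0 : ℤ) ≤ l := by positivity
          linarith
        exact not_isSoluble_real_twoIsogenyQuartic_of_neg hneg hd'neg ha hreal
      · exact hpos
    have h0 : d ∣ 448 * (l : ℤ) ^ 2 := ⟨d', hdd'⟩
    have h1 : d ∣ (14 * (l : ℤ)) ^ 6 := h0.trans ⟨16807 * (l : ℤ) ^ 4, by ring⟩
    have h14l : d ∣ 14 * (l : ℤ) := (hsqf.dvd_pow_iff_dvd (by norm_num)).mp h1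
    simp only [Finset.mem_union, Finset.mem_insert, Finset.mem_singleton]
    by_cases hld : (l : ℤ) ∣ d
    · obtain ⟨e, rfl⟩ := hld
      have he14 : e ∣ 14 := by
        have : (l : ℤ) * e ∣ (l : ℤ) * 14 := by rw [mul_comm (l : ℤ) 14]; exact h14l
        exact (mul_dvd_mul_iff_left hl0).mp this
      have hepos : 0 < e := by
        have : (0 : ℤ) < l := by exact_mod_cast hl.pos
        nlinarith
      have hele : e ≤ 14 := Int.le_of_dvd (by norm_num) he14
      have hd'e : e * d' = 448 * l := mul_left_cancel₀ hl0 (by linear_combination (-1 : ℤ) * hdd')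
      -- `e = 1`: the class `ℓ` dies at `2`
      have hne1 : e ≠ 1 := by
        rintro rfl
        have hd'1 : d' = 448 * (l : ℤ) := by linarith
        rw [mul_one, hd'1] at hpadic
        exact not_isSoluble_two_twoSplitThree_l hl8 (hpadic 2)
      obtain ⟨k, hk⟩ := he14
      interval_cases e <;> first | (exfalso; omega) | simp
    · have hcop : IsCoprime d (l : ℤ) := ((hlp.irreducible.coprime_iff_not_dvd).mpr hld).symm
      have h14 : d ∣ 14 := hcop.dvd_of_dvd_mul_right h14l
      have hle : d ≤ 14 := Int.le_of_dvd (by norm_num) h14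
      interval_cases d <;> first | (exfalso; omega) | simp
  have hab := hab_inertTwoTwist hl.pos
  obtain ⟨k, hk⟩ := exists_card_twoIsogenySelmerGroup_eq_two_pow hab
  have hle7 : (twoIsogenySelmerGroup (-42 * l) (448 * l ^ 2)).card ≤ 7 :=
    (Finset.card_le_card hsub).trans
      ((Finset.card_union_le _ _).trans (Nat.add_le_add Finset.card_le_six (Finset.card_singleton _).le))
  rw [hk] at hle7 ⊢
  have hk3 : k < 3 := (Nat.pow_lt_pow_iff_right one_lt_two).mp (lt_of_le_of_lt hle7 (by norm_num))
  calc 2 ^ k ≤ 2 ^ 2 := Nat.pow_le_pow_right two_pos (by omega)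
    _ = 4 := by norm_num

/-- **`#S'(−42ℓ, 448ℓ²) = #S(84ℓ, −28ℓ²) ≤ 2`** for a prime `ℓ ≡ 3 (mod 8)` with `(−7/ℓ) = +1`: the `ℓ`-classes die at
`ℓ`, `−1, −2, 7, 14` at `7`, `2, −14` at `ℓ`; `S' ⊆ {1, −7}`. [cite: SilvermanAEC2009, Prop. X.4.9]
[cite: Zywina2025, Lemma 3.1 (proof)] -/
theorem card_twoIsogenySelmerGroup'_twoSplitThreeTwist_le {l : ℕ} [Fact l.Prime] (hl8 : l % 8 = 3)
    (hl7 : legendreSym l (-7) = 1) :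
    (twoIsogenySelmerGroup' (-42 * l) (448 * l ^ 2)).card ≤ 2 := by
  have hl : l.Prime := Fact.out
  haveI : Fact (Nat.Prime 7) := ⟨by norm_num⟩
  have hlp : Prime (l : ℤ) := Nat.prime_iff_prime_int.mp hl
  have hl0 : (l : ℤ) ≠ 0 := by exact_mod_cast hl.ne_zero
  have hl2 : l ≠ 2 := by rintro rfl; norm_num at hl8
  have hl7' : l ≠ 7 := by
    rintro rfl
    have h0 : legendreSym 7 (-7) = 0 :=
      (legendreSym.eq_zero_iff 7 (-7)).mpr ((ZMod.intCast_zmod_eq_zero_iff_dvd (-7) 7).mpr ⟨-1, by norm_num⟩)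
    rw [h0] at hl7; norm_num at hl7
  obtain ⟨h7l, hl07, hlsq⟩ := seven_nonresidue_and_l_residue3 (by omega) hl7 hl7'
  obtain ⟨h2ns, h14ns⟩ := two_and_neg14_nonresidue hl8 h7l
  have hl07' : (l : ZMod 7) ≠ 0 := by exact_mod_cast hl07
  have hlsq' : IsSquare (l : ZMod 7) := by exact_mod_cast hlsq
  have htab := zmod_seven_table7_split3 (l : ZMod 7) (zmod_seven_residue_cases73 _ hl07' hlsq')
  have h32 : ((32 : ℤ) : ZMod l) ≠ 0 := by
    intro h
    have h' : ((2 ^ 5 : ℕ) : ZMod l) = 0 := by exact_mod_cast h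
    rw [ZMod.natCast_eq_zero_iff] at h'
    exact hl2 ((Nat.prime_dvd_prime_iff_eq hl Nat.prime_two).mp (hl.dvd_of_dvd_pow h'))
  have hns : ¬ IsSquare (((84 ^ 2 - 4 * (-28) : ℤ)) : ZMod l) := by
    rw [show ((84 : ℤ) ^ 2 - 4 * (-28) : ℤ) = 7 * 32 ^ 2 by norm_num]
    exact not_isSquare_mul_sq_zmod h32 ((legendreSym.eq_neg_one_iff l).mp h7l)
  have hA : (-2 * (-42 * l : ℤ)) = 84 * l := by ring
  have hB : ((-42 * l : ℤ) ^ 2 - 4 * (448 * l ^ 2)) = -28 * l ^ 2 := by ring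
  have hb : (-28 * l ^ 2 : ℤ) ≠ 0 := mul_ne_zero (by norm_num) (pow_ne_zero 2 hl0)
  have hsub : twoIsogenySelmerGroup' (-42 * l) (448 * l ^ 2) ⊆ ({1, -7} : Finset ℤ) := by
    intro d hd
    rw [twoIsogenySelmerGroup'_eq, hA, hB, mem_twoIsogenySelmerGroup_iff hb] at hd
    obtain ⟨hsqf, ⟨d', hdd'⟩, hloc⟩ := hd
    have hd'eq : (-28 * l ^ 2 : ℤ) / d = d' := by
      rw [hdd', Int.mul_ediv_cancel_left _ hsqf.ne_zero]
    rw [hd'eq] at hloc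
    obtain ⟨-, hpadic⟩ := hloc
    have hdisc : ∀ x y : ℤ, x * y = -28 * (l : ℤ) ^ 2 →
        (7 : ℤ) ∣ (84 * (l : ℤ)) ^ 2 - 4 * x * y ∧ ¬ (7 : ℤ) ^ 2 ∣ (84 * (l : ℤ)) ^ 2 - 4 * x * y := by
      intro x y hxy
      have e1 : (84 * (l : ℤ)) ^ 2 - 4 * x * y = 7168 * (l : ℤ) ^ 2 := by rw [mul_assoc, hxy]; ring
      rw [e1]
      refine ⟨⟨1024 * (l : ℤ) ^ 2, by ring⟩, not_sq_seven_dvd_of_not_dvd' fun h => hl7' ?_⟩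
      exact ((Nat.prime_dvd_prime_iff_eq (by norm_num) hl).mp h).symm
    have h7p : Prime (7 : ℤ) := Int.prime_iff_natAbs_prime.mpr (by norm_num)
    have hnd7 : ∀ k : ℤ, ¬ (7 : ℤ) ∣ k → ∀ n : ℕ, ¬ (7 : ℤ) ∣ k * (l : ℤ) ^ n := by
      intro k hk n h
      rcases h7p.dvd_or_dvd h with h5 | h5
      · exact hk h5
      · exact hl07 ((ZMod.intCast_zmod_eq_zero_iff_dvd _ 7).mpr (h7p.dvd_of_dvd_pow h5))
    have kill : ∀ x y : ℤ, x * y = -28 * (l : ℤ) ^ 2 → ¬ (7 : ℤ) ∣ x →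
        ((twoIsogenyQuartic (84 * l) x y).map (Int.castRingHom ℚ_[7])).IsSoluble →
        ∃ r : ZMod 7, ((x : ℤ) : ZMod 7) = r * r := by
      intro x y hxy hx hsol
      obtain ⟨hB1, hB2⟩ := hdisc x y hxy
      exact (isSquare_zmod_of_isSoluble_padic (p := 7) (by norm_num) hx hB1 hB2 hsol).2
    have kill' : ∀ x y : ℤ, x * y = -28 * (l : ℤ) ^ 2 → ¬ (7 : ℤ) ∣ y →
        ((twoIsogenyQuartic (84 * l) x y).map (Int.castRingHom ℚ_[7])).IsSoluble →
        ∃ r : ZMod 7, ((y : ℤ) : ZMod 7) = r * r := fun x y hxy hy hsol ↦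
      kill y x (by rw [mul_comm]; exact hxy) hy ((isSoluble_map_twoIsogenyQuartic_comm _ _ _ _).mp hsol)
    have h0 : d ∣ -28 * (l : ℤ) ^ 2 := ⟨d', hdd'⟩
    have h1 : d ∣ (14 * (l : ℤ)) ^ 2 := h0.trans ⟨-7, by ring⟩
    have h14l : d ∣ 14 * (l : ℤ) := (hsqf.dvd_pow_iff_dvd (by norm_num)).mp h1
    simp only [Finset.mem_insert, Finset.mem_singleton]
    by_cases hld : (l : ℤ) ∣ d
    · exfalso
      obtain ⟨e, rfl⟩ := hld
      have h1' : e * d' = -28 * l := mul_left_cancel₀ hl0 (by linear_combination (-1 : ℤ) * hdd')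
      have h3 : (l : ℤ) ∣ e * d' := ⟨-28, by rw [h1']; ring⟩
      rcases hlp.dvd_or_dvd h3 with h4 | h4
      · obtain ⟨e₁, rfl⟩ := h4
        exact hlp.not_unit (hsqf (l : ℤ) ⟨e₁, by ring⟩)
      · obtain ⟨e', rfl⟩ := h4
        have hm : e * e' = -28 := mul_left_cancel₀ hl0 (by linear_combination h1')
        exact not_isSoluble_padic_of_prime_dvd_coeffs (p := l) (c := 84) (by ring) rfl rfl hm hns (hpadic l)
    · have hcop : IsCoprime d (l : ℤ) := ((hlp.irreducible.coprime_iff_not_dvd).mpr hld).symm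
      have hd14 : d ∣ 14 := hcop.dvd_of_dvd_mul_right h14l
      have hle : d ≤ 14 := Int.le_of_dvd (by norm_num) hd14
      have hge : -14 ≤ d := by have := Int.le_of_dvd (by norm_num) ((Int.neg_dvd).mpr hd14); linarith
      have hnm1 : d ≠ -1 := by
        rintro rfl
        obtain ⟨r, hr⟩ := kill (-1) d' hdd'.symm (by decide) (hpadic 7)
        push_cast at hr
        exact (htab r).1 hr.symm
      have hnm2 : d ≠ -2 := by
        rintro rfl
        obtain ⟨r, hr⟩ := kill (-2) d' hdd'.symm (by decide) (hpadic 7)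
        push_cast at hr
        exact (htab r).2.1 hr.symm
      have hn7 : d ≠ 7 := by
        rintro rfl
        have hd'1 : d' = -4 * (l : ℤ) ^ 2 := by linarith
        obtain ⟨r, hr⟩ := kill' 7 d' hdd'.symm (by rw [hd'1]; exact hnd7 (-4) (by decide) 2) (hpadic 7)
        rw [hd'1] at hr; push_cast at hr
        exact (htab r).2.2.1 hr.symm
      have hn14 : d ≠ 14 := by
        rintro rfl
        have hd'1 : d' = -2 * (l : ℤ) ^ 2 := by linarith
        obtain ⟨r, hr⟩ := kill' 14 d' hdd'.symm (by rw [hd'1]; exact hnd7 (-2) (by decide) 2) (hpadic 7)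
        rw [hd'1] at hr; push_cast at hr
        exact (htab r).2.2.2 hr.symm
      -- `2` and `−14` die at `ℓ`
      have hn2 : d ≠ 2 := by
        rintro rfl
        have hd'1 : d' = (l : ℤ) ^ 2 * (-14) := by linarith
        exact not_isSoluble_padic_of_nonresidue_of_sq_dvd (p := l) (c := 84) (e' := -14) (by ring)
          hd'1 h2ns h14ns (hpadic l)
      have hnm14 : d ≠ -14 := by
        rintro rfl
        have hd'1 : d' = (l : ℤ) ^ 2 * 2 := by linarith
        exact not_isSoluble_padic_of_nonresidue_of_sq_dvd (p := l) (c := 84) (e' := 2) (by ring)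
          hd'1 h14ns h2ns (hpadic l)
      obtain ⟨k, hk⟩ := hd14
      interval_cases d <;> first | (exfalso; omega) | simp
  exact (Finset.card_le_card hsub).trans Finset.card_le_two

end Summit.BirchSwinnertonDyer.BirchSwinnertonDyer.Theorems.GoldfeldGoodTwists

end
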